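import Literature.NumberTheory.EllipticCurves.CasselsTateSelmerKolyvaginValue
import Literature.NumberTheory.EllipticCurves.CasselsTateLevelPrimary
import Literature.NumberTheory.EllipticCurves.HeegnerPointsKolyvaginEulerSystem
import HarnessLib

/-!
# The COUPLED Cassels–Tate telescope, XV: the (T-L2) VALUE CUT — the Cassels–Tate value clause of the
# display hT^κ REDUCED to McCallum's LOCAL leaf (Lemma 5.3 at level `κ`) on the CONSTRUCTED pairing
# (instantiation lane, planner D620 (e) / D625 (R1)(R3))

Crux `UpperOffV0HSYPlus` (stmt-BirchSwinnertonDyer-19804); display hT^κ = `…TailFourKappa` (p704180),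
value clauses hCTV_A (l.153–170) / hCTV_B (l.171–188): for a Kolyvagin pair `(ℓ, m)` and a Selmer
class `t` with `2^{N'} t = 0`, `N' ≤ κ ≤ j`, the displayed Selmer pairing `P_X` satisfies
`P_X ⟨2^j c_X(ℓm), _⟩ ⟨t, _⟩ ≠ 0` granted two LOCAL non-membership conditions at `λ ∋ ℓ` (memo (P2)).
On the rows' object of record (SPEC-K-TY § (CT-4)/(CT-DEF), planner D584) `P_X` is the Selmer
pull-back of the CONSTRUCTED level-`2^κ` Cassels–Tate pairing `B₂ = ctLevelPairing X (2^κ) e … inv …`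
on `Ш(X/K)[2^∞]` (`exists_primaryComponent_ctLevelPairing`, p700609) along
`ι₂ : Sel_{4^κ} → Ш[2^∞]` (`exists_selmerToPrimaryComponent`), and the tree COMPUTES its values:
`exists_bridge_ctLevelPairing` (`B₂ (ι₂ z) (ι₂ t) = ctLevelPairing … (ι z) (ι t)`) +
`ctLevelPairing_pullback_ne_zero_iff_localTerm_kolyvagin` (McCallum Prop. 4.7: non-zero iff the
first-case datum's local term at `λ` is).  Hence, GENERIC in the Weil datum `e`, the invariant family
`inv` and Milne's inputs `halt hPT' hH3 hfin` (cone-interim BINDERS, D590/D620 (g)), in the pinned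
`B₂`/`ι₂` and in `P` with `(P z t).1 = B₂ (ι₂ z) (ι₂ t)`:

* `valueClause_of_localLeaf` — the hCTV_X clause VERBATIM-SHAPED (curve `X` carrying `z, t`, partner
  `X'` carrying the pass-through class, parity predicate `par`) from: (T-L1)-type leaves `hcSel`
  (`c_X(ℓm)` Selmer away from `λ` and the places over `m`, McCallum Lemma 4.3), `htriv`
  (`X[4^κ] ⊆ X(K_q)` at Kolyvagin `q`), `hfix` (`X(K)[2^κ] = 0`), `hKol` (`(ℓ)` prime in `𝓞 K`), and
  the LOCAL LEAF `hloc` (same prefix ⊢ `D.localTerm e … inv (Sum.inr λ) ≠ 0` for every first-case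
  datum `D` with `D.b₁ = 2^{j-κ} c_X(ℓm)`, `ι_* D.b' = t` — McCallum Lemma 5.3 at level `κ`, rows'/K-lane).

Theorem-only (no definition, no named fact); nothing asserted on 19804; no stub closed; X12.CMAtTwo
NOT proved; BSD not claimed for any curve.  Sources: McCallum 1991 §4 Lemma 4.3, Prop. 4.7, §5
Lemma 5.3, Thm. 5.4 (proof, p. 288); Milne ADT I §6 Prop. 6.9; MEMO-bsd-cm-two §59, §64 (P2)(P5)(P6).
-/

-- every Summits module is named `Summit.<Summit>.<Problem>…`: the duplicated component is by design
set_option linter.dupNamespace false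
set_option autoImplicit false

noncomputable section

open scoped Classical AddSubgroup

open WeierstrassCurve Literature.NumberTheory.EllipticCurves Field NumberField IsDedekindDomain
  Literature.NumberTheory.GaloisRepresentations Literature.NumberTheory.GaloisCohomology
  Literature.NumberTheory.EllipticCurves.KolyvaginDescent
open Literature.NumberTheory.GaloisRepresentations.DiscreteGaloisModule (mu)

namespace Summit.BirchSwinnertonDyer.BirchSwinnertonDyer.Theorems.SylvesterTwoCoupledTelescope

section ValueCut

variable {K : Type} [Field K] [NumberField K] (X X' : WeierstrassCurve K) [X.IsElliptic]

/-- **The (T-L2) VALUE CUT** (module docstring): hT^κ's Cassels–Tate value clause for the curve `X`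
(partner `X'`, parity `par`) from the (T-L1)-type leaves `hcSel`/`htriv`/`hfix`/`hKol` and the LOCAL
LEAF `hloc`, for the Selmer pull-back `P` of the constructed level-`2^κ` pairing `B₂` (`hB₂`, `hι₂`,
`hP`).  McCallum: «`⟨p^j c(ℓm), t⟩ = inv_λ(…) ≠ 0` since the groups `E(K_λ)/p^M` and `H¹(K_λ, E)_{p^M}`
pair non-trivially» — the second half is `hloc`.
[cite: McCallumLMS1991, §4 Prop. 4.7, §5 Lemma 5.3, Thm. 5.4 (proof)]
[cite: MilneADT2006, Ch. I §6, proof of Prop. 6.9] -/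
theorem valueClause_of_localLeaf (κ : ℕ)
    -- the Weil datum at level `4^κ`, the invariant family and Milne's inputs (cone-interim BINDERS)
    (e : geomTorsion X ((2 ^ κ * 2 ^ κ : ℕ) : ℤ) → geomTorsion X ((2 ^ κ * 2 ^ κ : ℕ) : ℤ) →
      AlgebraicClosure K)
    (hμ : ∀ S T, e S T ^ (2 ^ κ * 2 ^ κ) = 1)
    (hadd₁ : ∀ S₁ S₂ T, e (S₁ + S₂) T = e S₁ T * e S₂ T)
    (hadd₂ : ∀ S T₁ T₂, e S (T₁ + T₂) = e S T₁ * e S T₂)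
    (hgal : ∀ (σ : absoluteGaloisGroup K) (S T : geomTorsion X ((2 ^ κ * 2 ^ κ : ℕ) : ℤ)),
      σ • e S T = e (σ • S) (σ • T))
    (halt : ∀ T, e T T = 1) (inv : LocalInvariants K (2 ^ κ * 2 ^ κ))
    (hPT' : inv.SumInvLocalizationEqZero)
    (hH3 : ∀ c : galoisCohomology (mu K (2 ^ κ * 2 ^ κ)) 3,
      (∀ v : Place K, galoisCohomology.localization (mu K (2 ^ κ * 2 ^ κ)) v 3 c = 0) → c = 0)
    (hfin : ∀ D : GeneralCaseData X (2 ^ κ) e hμ hadd₁ hadd₂ hgal, ∃ S : Finset (Place K),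
      ∀ v ∉ S, D.localTerm inv v = 0)
    -- the constructed pairing on `Ш(X/K)[2^∞]`, its Selmer pull-back map, and the displayed `P`
    (hle : AddCommGroup.primaryComponent X.sha 2 ≤ (X.sha)[2 ^ κ])
    (B₂ : AddCommGroup.primaryComponent X.sha 2 →+ AddCommGroup.primaryComponent X.sha 2 →+
      AddCircle (1 : ℚ))
    (hB₂ : ∀ a b, B₂ a b = ctLevelPairing X (2 ^ κ) e hμ hadd₁ hadd₂ hgal inv halt hPT' hH3 hfin
      ⟨a, hle a.2⟩ ⟨b, hle b.2⟩)
    (ι₂ : selmerGroup X ((2 ^ κ * 2 ^ κ : ℕ) : ℤ) →+ AddCommGroup.primaryComponent X.sha 2)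
    (hι₂ : ∀ z, (((ι₂ z : AddCommGroup.primaryComponent X.sha 2) : X.sha) : X.galH1) =
      torsionH1ToH1 X ((2 ^ κ * 2 ^ κ : ℕ) : ℤ) z)
    (P : selmerGroup X ((2 ^ κ * 2 ^ κ : ℕ) : ℤ) →+ selmerGroup X ((2 ^ κ * 2 ^ κ : ℕ) : ℤ) →+
      AddCircle (1 : ℚ) × AddCircle (1 : ℚ))
    (hP : ∀ z t, (P z t).1 = B₂ (ι₂ z) (ι₂ t))
    -- the Kolyvagin predicate, the parity, the classes of `X` and of the partner `X'`
    (Kol : ℕ → Prop) (hKol : ∀ ℓ, Kol ℓ → ℓ.Prime ∧ (Ideal.span {(ℓ : 𝓞 K)}).IsPrime)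
    (par : ℕ → Prop)
    (cX : ℕ → galH1Torsion X ((2 ^ κ * 2 ^ κ : ℕ) : ℤ))
    (cX' : ℕ → galH1Torsion X' ((2 ^ κ * 2 ^ κ : ℕ) : ℤ))
    -- (T-L1)-type leaves: Selmer away from `λ` and `m` (McCallum 4.3); `X[4^κ] ⊆ X(K_q)` at Kolyvagin `q`
    (hcSel : ∀ ℓ m : ℕ, Kol ℓ → KolSupp Kol (ℓ * m) → ¬ ℓ ∣ m →
      ∀ v₀ : HeightOneSpectrum (𝓞 K), (ℓ : 𝓞 K) ∈ v₀.asIdeal →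
      ∀ v : Place K, v ≠ Sum.inr v₀ →
        (∀ q : HeightOneSpectrum (𝓞 K), (∃ r ∈ m.primeFactors, (r : 𝓞 K) ∈ q.asIdeal) →
          v ≠ Sum.inr q) →
        cX (ℓ * m) ∈ selmerLocalKer X (Place.Completion v) ((2 ^ κ * 2 ^ κ : ℕ) : ℤ))
    (htriv : ∀ r : ℕ, Kol r → ∀ q : HeightOneSpectrum (𝓞 K), (r : 𝓞 K) ∈ q.asIdeal →
      ∀ (g : absoluteGaloisGroup (Place.Completion (Sum.inr q : Place K)))
        (Q : geomTorsion X ((2 ^ κ * 2 ^ κ : ℕ) : ℤ)),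
        absGaloisRestrict K (Place.Completion (Sum.inr q : Place K)) g • Q = Q)
    -- `X(K)[2^κ] = 0`
    (hfix : ∀ Q : geomTorsion X ((2 ^ κ : ℕ) : ℤ), (∀ σ : absoluteGaloisGroup K, σ • Q = Q) → Q = 0)
    -- THE LOCAL LEAF (McCallum Lemma 5.3 at level `κ`)
    (hloc : ∀ ℓ m : ℕ, Kol ℓ → KolSupp Kol (ℓ * m) → ¬ ℓ ∣ m → par m →
      ∀ (j N' a b : ℕ) (t : galH1Torsion X ((2 ^ κ * 2 ^ κ : ℕ) : ℤ))
        (ht : t ∈ selmerGroup X ((2 ^ κ * 2 ^ κ : ℕ) : ℤ))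
        (hz : ((2 : ℤ) ^ j) • cX (ℓ * m) ∈ selmerGroup X ((2 ^ κ * 2 ^ κ : ℕ) : ℤ)),
        ((2 : ℤ) ^ N') • t = 0 →
        (∀ q ∈ m.primeFactors, ∀ v : HeightOneSpectrum (𝓞 K), (q : 𝓞 K) ∈ v.asIdeal →
          t ∈ X.torsionLocalKer (v.adicCompletion K) ((2 ^ κ * 2 ^ κ : ℕ) : ℤ)) →
        κ ≤ j → N' ≤ κ → N' ≤ j → a + b + 1 = N' →
        (∀ v : HeightOneSpectrum (𝓞 K), (ℓ : 𝓞 K) ∈ v.asIdeal →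
          ((2 : ℤ) ^ (a + (j - N'))) • cX' m ∉
            X'.torsionLocalKer (v.adicCompletion K) ((2 ^ κ * 2 ^ κ : ℕ) : ℤ)) →
        (∀ v : HeightOneSpectrum (𝓞 K), (ℓ : 𝓞 K) ∈ v.asIdeal → ((2 : ℤ) ^ b) • t ∉
          X.torsionLocalKer (v.adicCompletion K) ((2 ^ κ * 2 ^ κ : ℕ) : ℤ)) →
        ∀ v₀ : HeightOneSpectrum (𝓞 K), (ℓ : 𝓞 K) ∈ v₀.asIdeal →
        ∀ D : FirstCaseData X (2 ^ κ), D.b₁ = ((2 : ℤ) ^ (j - κ)) • cX (ℓ * m) →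
          galoisCohomology.map (inclKD X (2 ^ κ) (2 ^ κ)) 1 D.b' = t →
          D.localTerm e hμ hadd₁ hadd₂ hgal inv (Sum.inr v₀) ≠ 0) :
    ∀ ℓ m : ℕ, Kol ℓ → KolSupp Kol (ℓ * m) → ¬ ℓ ∣ m → par m →
      ∀ (j N' a b : ℕ) (t : galH1Torsion X ((2 ^ κ * 2 ^ κ : ℕ) : ℤ))
        (ht : t ∈ selmerGroup X ((2 ^ κ * 2 ^ κ : ℕ) : ℤ))
        (hz : ((2 : ℤ) ^ j) • cX (ℓ * m) ∈ selmerGroup X ((2 ^ κ * 2 ^ κ : ℕ) : ℤ)),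
        ((2 : ℤ) ^ N') • t = 0 →
        (∀ q ∈ m.primeFactors, ∀ v : HeightOneSpectrum (𝓞 K), (q : 𝓞 K) ∈ v.asIdeal →
          t ∈ X.torsionLocalKer (v.adicCompletion K) ((2 ^ κ * 2 ^ κ : ℕ) : ℤ)) →
        κ ≤ j → N' ≤ κ → N' ≤ j → a + b + 1 = N' →
        (∀ v : HeightOneSpectrum (𝓞 K), (ℓ : 𝓞 K) ∈ v.asIdeal →
          ((2 : ℤ) ^ (a + (j - N'))) • cX' m ∉
            X'.torsionLocalKer (v.adicCompletion K) ((2 ^ κ * 2 ^ κ : ℕ) : ℤ)) →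
        (∀ v : HeightOneSpectrum (𝓞 K), (ℓ : 𝓞 K) ∈ v.asIdeal → ((2 : ℤ) ^ b) • t ∉
          X.torsionLocalKer (v.adicCompletion K) ((2 ^ κ * 2 ^ κ : ℕ) : ℤ)) →
        P ⟨_, hz⟩ ⟨t, ht⟩ ≠ 0 := by
  intro ℓ m hℓ hsupp hndvd hpar j N' a b t ht hz hN' hq hκj hN'κ hN'j hab hX' hX h0
  -- ### the place `λ = (ℓ)` of `K`
  obtain ⟨hℓp, hℓP⟩ := hKol ℓ hℓ
  have hℓ0 : (ℓ : 𝓞 K) ≠ 0 := by exact_mod_cast hℓp.ne_zero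
  let v₀ : HeightOneSpectrum (𝓞 K) :=
    ⟨Ideal.span {(ℓ : 𝓞 K)}, hℓP, by rwa [Ne, Ideal.span_singleton_eq_bot]⟩
  have hv₀ : (ℓ : 𝓞 K) ∈ v₀.asIdeal := Ideal.mem_span_singleton_self _
  -- ### the bridge `B₂ (ι₂ z) (ι₂ t) = ctLevelPairing … (ι z) (ι t)`
  obtain ⟨ι, hι, -, hbridge⟩ := exists_bridge_ctLevelPairing X (2 ^ κ) e hμ hadd₁ hadd₂ hgal inv halt
    hPT' hH3 hfin hle B₂ hB₂ ι₂ hι₂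
  -- ### the first-case datum of the Kolyvagin pair: `z = 2^κ • (2^{j-κ} • c)`, `2^κ • t = 0`
  have hz' : ((⟨_, hz⟩ : selmerGroup X ((2 ^ κ * 2 ^ κ : ℕ) : ℤ)) :
      galH1Torsion X ((2 ^ κ * 2 ^ κ : ℕ) : ℤ)) =
      ((2 ^ κ : ℕ) : ℤ) • ((2 : ℤ) ^ (j - κ)) • cX (ℓ * m) := by
    change ((2 : ℤ) ^ j) • cX (ℓ * m) = _
    rw [smul_smul]
    congr 1
    push_cast
    rw [← pow_add, Nat.add_sub_cancel' hκj]
  have hmt : ((2 ^ κ : ℕ) : ℤ) • ((⟨t, ht⟩ : selmerGroup X ((2 ^ κ * 2 ^ κ : ℕ) : ℤ)) :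
      galH1Torsion X ((2 ^ κ * 2 ^ κ : ℕ) : ℤ)) = 0 := by
    change ((2 ^ κ : ℕ) : ℤ) • t = 0
    have h2 : ((2 ^ κ : ℕ) : ℤ) = (2 : ℤ) ^ (κ - N') * (2 : ℤ) ^ N' := by
      push_cast
      rw [← pow_add, Nat.sub_add_cancel hN'κ]
    rw [h2, mul_zsmul, hN', zsmul_zero]
  obtain ⟨D, hD₁, hDt⟩ := exists_firstCaseData_kolyvagin ⟨_, hz⟩ ⟨t, ht⟩ (cX (ℓ * m))
    ((2 : ℤ) ^ (j - κ)) hz' hfix hmt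
  -- ### the value theorem's local hypotheses at the places over `m`
  have hc : ∀ v : Place K, v ≠ Sum.inr v₀ →
      (∀ q ∈ {q : HeightOneSpectrum (𝓞 K) | ∃ r ∈ m.primeFactors, (r : 𝓞 K) ∈ q.asIdeal},
        v ≠ Sum.inr q) →
      cX (ℓ * m) ∈ selmerLocalKer X (Place.Completion v) ((2 ^ κ * 2 ^ κ : ℕ) : ℤ) :=
    fun v hv hT ↦ hcSel ℓ m hℓ hsupp hndvd v₀ hv₀ v hv fun q hq' ↦ hT q hq'
  have hk : (2 ^ κ * 2 ^ κ : ℕ) ≠ 0 := mul_ne_zero (pow_ne_zero κ two_ne_zero)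
    (pow_ne_zero κ two_ne_zero)
  have htT : ∀ q ∈ {q : HeightOneSpectrum (𝓞 K) | ∃ r ∈ m.primeFactors, (r : 𝓞 K) ∈ q.asIdeal},
      galoisCohomology.res (X.torsionGaloisModule ((2 ^ κ * 2 ^ κ : ℕ) : ℤ))
        (Place.Completion (Sum.inr q : Place K)) 1
        ((⟨t, ht⟩ : selmerGroup X ((2 ^ κ * 2 ^ κ : ℕ) : ℤ)) :
          galH1Torsion X ((2 ^ κ * 2 ^ κ : ℕ) : ℤ)) = 0 := by
    intro q hq'
    obtain ⟨r, hr, hrq⟩ := hq'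
    -- `char K_q = 0` (the tree's theorem `charZero_placeCompletion`, as an instance for this call only)
    haveI := charZero_placeCompletion (Sum.inr q : Place K)
    exact (mem_torsionLocalKer_iff_res_eq_zero X (Place.Completion (Sum.inr q : Place K)) hk t).mp
      (hq r hr q hrq)
  have htrivT : ∀ q ∈ {q : HeightOneSpectrum (𝓞 K) | ∃ r ∈ m.primeFactors, (r : 𝓞 K) ∈ q.asIdeal},
      ∀ (g : absoluteGaloisGroup (Place.Completion (Sum.inr q : Place K)))
        (Q : geomTorsion X ((2 ^ κ * 2 ^ κ : ℕ) : ℤ)),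
        absGaloisRestrict K (Place.Completion (Sum.inr q : Place K)) g • Q = Q := by
    intro q hq' g Q
    obtain ⟨r, hr, hrq⟩ := hq'
    have hr' : r ∈ (ℓ * m).primeFactors := by
      obtain ⟨hrp, hrm, -⟩ := Nat.mem_primeFactors.mp hr
      exact Nat.mem_primeFactors.mpr ⟨hrp, dvd_mul_of_dvd_right hrm ℓ, hsupp.1.ne_zero⟩
    exact htriv r (hsupp.2 r hr') q hrq g Q
  -- ### McCallum Prop. 4.7 on the constructed pairing + the local leaf
  have hval := (ctLevelPairing_pullback_ne_zero_iff_localTerm_kolyvagin e hμ hadd₁ hadd₂ hgal inv halt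
    hPT' hH3 hfin ι hι ⟨_, hz⟩ ⟨t, ht⟩ (cX (ℓ * m)) ((2 : ℤ) ^ (j - κ)) hz' v₀ _ hc htT htrivT D hD₁
    hDt).mpr (hloc ℓ m hℓ hsupp hndvd hpar j N' a b t ht hz hN' hq hκj hN'κ hN'j hab hX' hX v₀ hv₀ D
      hD₁ hDt)
  have h1 : (P ⟨_, hz⟩ ⟨t, ht⟩).1 = 0 := by rw [h0, Prod.fst_zero]
  rw [hP, hbridge] at h1
  exact hval h1

end ValueCut

end Summit.BirchSwinnertonDyer.BirchSwinnertonDyer.Theorems.SylvesterTwoCoupledTelescope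

end
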